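import Literature.Computability.AlgebraicComplexity.TableauEvalClosedForm
import Literature.Computability.AlgebraicComplexity.CircuitGateSemantics
import Literature.NumberTheory.DiophantineGeometry.SchurWeylPlethysm
import HarnessLib

/-!
# Matrix variables, the reversed lexicographic enumeration, and the weight of a certificate

Lean checker of the GCT multiplicity-obstruction engine (cell `pub-gct`; honest framing: rung-1
multiplicity-obstruction search for permanent versus determinant at small `(n, m)`, no claim about
VP ≠ VNP or P ≠ NP), step H1e (first part): the instantiation data for `σ = MatIdx m` (the
tree's lexicographically ordered matrix variables, `SchurWeylPlethysm.lean`).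

* `matIdxEnum m : Enum (MatIdx m) (m·m)` — certificate variable `i` ↦ the `i`-th LARGEST matrix
  entry `x i = matIdxEquiv m (m²-1-i)` (referee ref2's relabelling `ρ(a,b) = (m-1-a, m-1-b)`,
  GATE §8L L4), an antitone enumeration (`isAntitoneEnum_matIdx`);
* `dualOfPartition_toMatIdx_x` — the tree's obstruction weight
  `(Weight.dualOfPartition (m·m) μ).toMatIdx` takes the value `-μ_i` at `x i`;
* `card_filter_height_eq` — the number of columns of height `> i` of a network whose shape is
  `λ` is `λ_i`; `sortedParts_coe_of_chain` — a weakly decreasing list is its own sorted-parts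
  list. Together: the weight hypothesis of `TabM.tabPoly_mem_highestWeightSpace` holds for the
  tableau datum of a certificate's network with `χ = λ^*`.

Elementary [folklore].
-/

noncomputable section

open scoped BigOperators

namespace Literature.Computability.AlgebraicComplexity

namespace TableauEval

open _root_.Literature.NumberTheory.DiophantineGeometry

/-! ## §1 The reversed lexicographic enumeration of the matrix entries -/

/-- `m·m - 1 - i < m·m` for `m ≠ 0`. [folklore] -/
theorem sub_one_sub_lt (m : ℕ) [NeZero m] (i : ℕ) : m * m - 1 - i < m * m := by
  have : 0 < m * m := Nat.mul_pos (Nat.pos_of_ne_zero (NeZero.ne m)) (Nat.pos_of_ne_zero (NeZero.ne m))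
  omega

/-- **The reversed lexicographic enumeration**: certificate variable `i < m²` is the `i`-th
largest entry of `MatIdx m`, `x i = matIdxEquiv m (m²-1-i)`; inverse `xinv`. [folklore] -/
def matIdxEnum (m : ℕ) [NeZero m] : Enum (MatIdx m) (m * m) where
  x i := matIdxEquiv m ⟨m * m - 1 - i, sub_one_sub_lt m i⟩
  xinv v := m * m - 1 - ((matIdxEquiv m).symm v : ℕ)
  xinv_lt v := sub_one_sub_lt m _
  x_xinv v := by
    have h : ((matIdxEquiv m).symm v : ℕ) < m * m := ((matIdxEquiv m).symm v).isLt
    have : (⟨m * m - 1 - (m * m - 1 - ((matIdxEquiv m).symm v : ℕ)), sub_one_sub_lt m _⟩ :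
        Fin (m * m)) = (matIdxEquiv m).symm v := by
      apply Fin.ext; simp only; omega
    rw [this, OrderIso.apply_symm_apply]
  xinv_x i hi := by
    rw [OrderIso.symm_apply_apply]
    simp only
    omega

/-- The reversed lexicographic enumeration is antitone and exhaustive. [folklore] -/
theorem isAntitoneEnum_matIdx (m : ℕ) [NeZero m] : IsAntitoneEnum (matIdxEnum m).x (m * m) where
  anti i j hij hj := by
    change matIdxEquiv m _ < matIdxEquiv m _
    apply (matIdxEquiv m).strictMono
    rw [Fin.lt_def]
    simp only
    omega
  surj v := ⟨(matIdxEnum m).xinv v, (matIdxEnum m).xinv_lt v, (matIdxEnum m).x_xinv v⟩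

/-! ## §2 The obstruction weight at the enumerated variables -/

/-- **`λ^*` at `x i` is `-λ_i`**: the tree's weight `(Weight.dualOfPartition (m·m) μ).toMatIdx`
evaluated at the `i`-th largest matrix entry. [folklore] -/
theorem dualOfPartition_toMatIdx_x (m : ℕ) [NeZero m] {e : ℕ} (μ : Nat.Partition e) (i : ℕ)
    (hi : i < m * m) :
    (Weight.dualOfPartition (m * m) μ).toMatIdx ((matIdxEnum m).x i) =
      -((μ.sortedParts.getD i 0 : ℕ) : ℤ) := by
  unfold Weight.toMatIdx matIdxEnum Weight.dualOfPartition Weight.dual Weight.ofPartition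
  simp only [OrderIso.symm_apply_apply, Fin.rev]
  congr 3
  omega

/-! ## §3 Column counts of a network of shape `λ` -/

/-- A `Fin`-indexed filter count over a list is the length of the filtered list. [folklore] -/
theorem card_filter_get {α : Type*} (p : α → Prop) [DecidablePred p] : ∀ l : List α,
    (Finset.univ.filter fun j : Fin l.length => p (l.get j)).card = (l.filter fun a => p a).length
  | [] => by simp
  | a :: l => by
    have hsplit : (Finset.univ.filter fun j : Fin (a :: l).length => p ((a :: l).get j)).card =
        (if p a then 1 else 0) + (Finset.univ.filter fun j : Fin l.length => p (l.get j)).card := by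
      rw [Finset.card_filter, Finset.card_filter]
      exact Fin.sum_univ_succ fun j : Fin (l.length + 1) => if p ((a :: l).get j) then 1 else 0
    rw [hsplit, card_filter_get p l, List.filter_cons]
    by_cases h : p a
    · simp [h]; omega
    · simp [h]

/-- **Columns taller than `i` are counted by `λ_i`** for a network of shape `λ` (with alternator
lists as long as label lists). [folklore] -/
theorem card_filter_height_eq (N : Network) (lam : List ℕ) (hshape : N.shape = lam)
    (hlen : ∀ c ∈ N.cols, c.vars.length = c.labels.length) (i : ℕ) :
    (Finset.univ.filter fun c : Fin N.cols.length => i < (N.cols.get c).vars.length).card =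
      lam.getD i 0 := by
  rw [card_filter_get (fun c : Column => i < c.vars.length)]
  have hvl : (N.cols.filter fun c => decide (i < c.vars.length)) =
      N.cols.filter fun c => decide (i < c.labels.length) :=
    List.filter_congr fun c hc => by rw [hlen c hc]
  rw [hvl, ← hshape, Network.shape]
  set H := (N.cols.map fun c => c.labels.length).foldr max 0 with hH
  by_cases hi : i < H
  · rw [List.getD_eq_getElem _ _ (by simpa using hi), List.getElem_map, List.getElem_range]
  · rw [List.getD_eq_default _ _ (by simpa using not_lt.mp hi)]
    rw [List.length_eq_zero_iff, List.filter_eq_nil_iff]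
    intro c hc
    have : c.labels.length ≤ H := ArithCircuit.le_foldr_max_of_mem (List.mem_map.mpr ⟨c, hc, rfl⟩)
    simp only [decide_eq_true_eq, not_lt]
    omega

/-! ## §4 Sorted parts of a decreasing list -/

/-- The structural check's adjacent-comparison condition makes the list a `≥`-chain. [folklore] -/
theorem isChain_ge_of_zipWith : ∀ l : List ℕ,
    (List.zipWith (fun a b => decide (b ≤ a)) l l.tail).all id = true → l.IsChain (· ≥ ·)
  | [] , _ => List.IsChain.nil
  | [a], _ => List.IsChain.singleton a
  | a :: b :: l, h => by
    rw [List.tail_cons, List.zipWith_cons_cons, List.all_cons, Bool.and_eq_true, id,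
      decide_eq_true_eq] at h
    exact List.IsChain.cons_cons h.1 (isChain_ge_of_zipWith (b :: l) h.2)

/-- A weakly decreasing list of positive parts is the sorted-parts list of its partition.
[folklore] -/
theorem sortedParts_eq_of_isChain {e : ℕ} (μ : Nat.Partition e) (l : List ℕ)
    (hμ : μ.parts = (l : Multiset ℕ)) (hl : l.IsChain (· ≥ ·)) : μ.sortedParts = l := by
  rw [Nat.Partition.sortedParts, hμ, Multiset.coe_sort]
  exact List.mergeSort_eq_self _ (List.isChain_iff_pairwise.mp hl)

end TableauEval

end Literature.Computability.AlgebraicComplexity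

end
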